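import Summits.BirchSwinnertonDyer.BirchSwinnertonDyer.Theorems.Rank2ShaRowKit
import Summits.BirchSwinnertonDyer.BirchSwinnertonDyer.Theorems.Rank1ResidualIntModelSurjectivity
import HarnessLib

/-!
# BirchSwinnertonDyer — rank-2 `Ш[p^∞]` cell: the KERNEL SERRE WITNESS of `ρ̄_{E,p}` surjective
# (census hypothesis H5, frame «kato-bound»)

HONEST FRAMING (cell `b2b-bsdr2sha`, run/shared/lean/b2b/bsd-rank2-sha/): per-pair certified
theorems «cited hypotheses ∧ certified computation ⇒ `Ш(E/ℚ)[p^∞]` finite of order `p^k`» for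
rank-2 curves at good ordinary primes; NO claim on BSD in rank `≥ 2`, no class-level theorem, every
published input is a NAMED HYPOTHESIS of the tree (nothing is asserted or minted here).

In the frame «kato-bound» (`Rank2ShaOrderKatoRow.lean`, rows without a Skinner–Urban (ram) prime) the
image hypothesis of Kato's integral clause is the census bit H5, `ρ̄_{E,p}` SURJECTIVE, decided by the
engines through Serre's criterion (Invent. Math. 15 (1972), §2.8 Prop. 19: three Frobenius elements —
split with non-zero trace, non-split with non-zero trace, and `u = tr²/det ∉ {0,1,2,4}`,
`u² − 3u + 1 ≠ 0` — generate `GL₂(𝔽_p)` together with `det` onto, `p ≥ 5`). The rank-`≤ 1` cell's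
`Rank1ResidualIntModelSurjectivity.lean` proves exactly this from an integer model and three kernel
point counts (`hasSurjectiveModNGaloisRep_of_intModel_of_serreWitnesses`). THIS file packages the three
witnesses as kernel data with ONE Boolean test, in the style of `SuWitness` (`Rank2ShaRowKit.lean`):

* `SurjWitness = (l₁, sq₁, n₁, w₁, l₂, sq₂, n₂, l₃, sq₃, n₃, u)`: good odd primes `lᵢ ≠ p` with
  `#Ẽ(𝔽_{lᵢ}) = nᵢ` (so `aᵢ = lᵢ + 1 − nᵢ`), an integer square root `w₁` of `a₁² − 4l₁` modulo `p`
  (split, `a₁² − 4l₁ ≢ 0`, `a₁ ≢ 0`), NO square root of `a₂² − 4l₂` among `t < p` (non-split, `a₂ ≢ 0`),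
  and `u < p` with `a₃² ≡ u·l₃`, `u ∉ {0,1,2,4}`, `u² − 3u + 1 ≢ 0 (mod p)`;
* `SurjWitness.check e p` (Boolean, integer arithmetic only) and its soundness `surj_of_check`:
  `(e ⊗ ℚ).HasSurjectiveModNGaloisRep p` for the globally minimal integer model `e`.

References: J.-P. Serre, Invent. Math. 15 (1972), §2.8 Prop. 19, §5.2 (iii) [Serre1972]; B. Mazur,
Invent. Math. 44 (1978), Prop. 6.3 (1) [Mazur1978]; W. Stein, C. Wuthrich, Math. Comp. 82 (2013), §7
(surjectivity as the hypothesis of the algorithm) [SteinWuthrich2013].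
-/

set_option autoImplicit false

-- single-conjunct summit: `Summit.BirchSwinnertonDyer.BirchSwinnertonDyer.…` repeats the name by design
set_option linter.dupNamespace false

noncomputable section

open scoped Classical

open WeierstrassCurve Literature.NumberTheory.EllipticCurves
  Summit.BirchSwinnertonDyer.BirchSwinnertonDyer.Rank2Observatory
  Summit.BirchSwinnertonDyer.BirchSwinnertonDyer.Rank1Residual.IntModel

namespace Summit.BirchSwinnertonDyer.BirchSwinnertonDyer.Rank2Sha

/-- The KERNEL SERRE WITNESS of `ρ̄_{E,p}` surjective at a cell `(E, p)`, `p ≥ 5`: three good odd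
primes `lᵢ ≠ p` with their point counts `nᵢ = #Ẽ(𝔽_{lᵢ})` (trial-division data `sqᵢ = ⌊√lᵢ⌋`), a
square-root witness `w₁` for the split element, and the ratio witness `u` for the third element.
[cite: Serre1972, §2.8 Prop. 19] -/
structure SurjWitness where
  /-- first good prime (split Frobenius: `a₁² − 4l₁` a non-zero square mod `p`, `a₁ ≢ 0`) -/
  l₁ : ℕ
  /-- `⌊√l₁⌋` -/
  sq₁ : ℕ
  /-- `#Ẽ(𝔽_{l₁})` -/
  n₁ : ℕ
  /-- `w₁² ≡ a₁² − 4l₁ (mod p)` -/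
  w₁ : ℕ
  /-- second good prime (non-split Frobenius: `a₂² − 4l₂` a non-square mod `p`, `a₂ ≢ 0`) -/
  l₂ : ℕ
  /-- `⌊√l₂⌋` -/
  sq₂ : ℕ
  /-- `#Ẽ(𝔽_{l₂})` -/
  n₂ : ℕ
  /-- third good prime (`u = a₃²/l₃ ∉ {0,1,2,4}`, `u² − 3u + 1 ≢ 0`) -/
  l₃ : ℕ
  /-- `⌊√l₃⌋` -/
  sq₃ : ℕ
  /-- `#Ẽ(𝔽_{l₃})` -/
  n₃ : ℕ
  /-- `u < p` with `a₃² ≡ u·l₃ (mod p)` -/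
  u : ℕ
  deriving Repr, DecidableEq, Inhabited

namespace SurjWitness

variable (s : SurjWitness)

/-- The test of one good odd prime `l ≠ p` with kernel point count `n`. [folklore] -/
def primeOK (e : WeierstrassCurve ℤ) (p l sq n : ℕ) : Bool :=
  Tam.TamLocal.primeB l sq && decide (l ≠ 2) && decide (l ≠ p) && decide (¬ ((l : ℤ) ∣ e.Δ)) &&
    decide (curveCount l e = n)

/-- **The kernel test of a Serre witness** against the integer model `e` at the prime `p ≥ 5`: the three
primes are good, odd, `≠ p` with the stated point counts; with `aᵢ = lᵢ + 1 − nᵢ`: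
`p ∣ w₁² − (a₁² − 4l₁)`, `p ∤ a₁² − 4l₁`, `p ∤ a₁`; no `t < p` with `p ∣ t² − (a₂² − 4l₂)`, `p ∤ a₂`;
`u < p`, `p ∣ a₃² − u·l₃`, `u ∉ {0, 1, 2, 4}`, `p ∤ u² − 3u + 1`. [cite: Serre1972, §2.8 Prop. 19] -/
def check (e : WeierstrassCurve ℤ) (p : ℕ) : Bool :=
  let a₁ : ℤ := (s.l₁ : ℤ) + 1 - s.n₁
  let a₂ : ℤ := (s.l₂ : ℤ) + 1 - s.n₂
  let a₃ : ℤ := (s.l₃ : ℤ) + 1 - s.n₃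
  decide (5 ≤ p) &&
    primeOK e p s.l₁ s.sq₁ s.n₁ && primeOK e p s.l₂ s.sq₂ s.n₂ && primeOK e p s.l₃ s.sq₃ s.n₃ &&
    decide ((p : ℤ) ∣ (s.w₁ : ℤ) ^ 2 - (a₁ ^ 2 - 4 * s.l₁)) && decide (¬ ((p : ℤ) ∣ a₁ ^ 2 - 4 * s.l₁)) &&
    decide (¬ ((p : ℤ) ∣ a₁)) &&
    ((List.range p).all fun t => !decide ((p : ℤ) ∣ (t : ℤ) ^ 2 - (a₂ ^ 2 - 4 * s.l₂))) &&
    decide (¬ ((p : ℤ) ∣ a₂)) &&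
    decide (s.u < p) && decide ((p : ℤ) ∣ a₃ ^ 2 - s.u * s.l₃) && decide (s.u ≠ 0) && decide (s.u ≠ 1) &&
    decide (s.u ≠ 2) && decide (s.u ≠ 4) && decide (¬ ((p : ℤ) ∣ (s.u : ℤ) ^ 2 - 3 * s.u + 1))

variable {s} {e : WeierstrassCurve ℤ} {p : ℕ}

/-- Unpacking `primeOK`. [folklore] -/
theorem primeOK_spec {l sq n : ℕ} (h : primeOK e p l sq n = true) :
    l.Prime ∧ l ≠ 2 ∧ l ≠ p ∧ ¬ ((l : ℤ) ∣ e.Δ) ∧ curveCount l e = n := by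
  simp only [primeOK, Bool.and_eq_true, decide_eq_true_eq] at h
  exact ⟨Tam.TamLocal.prime_of_primeB h.1.1.1.1, h.1.1.1.2, h.1.1.2, h.1.2, h.2⟩

/-- An integer `x` with `p ∣ w² − x` is a square in `ℤ/p`. [folklore] -/
theorem isSquare_of_dvd {w x : ℤ} (h : (p : ℤ) ∣ w ^ 2 - x) : IsSquare ((x : ℤ) : ZMod p) := by
  refine ⟨(w : ZMod p), ?_⟩
  have h0 : (((w ^ 2 - x : ℤ)) : ZMod p) = 0 := (ZMod.intCast_zmod_eq_zero_iff_dvd _ p).mpr h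
  push_cast at h0
  linear_combination -h0

/-- An integer `x` with no `t < p`, `p ∣ t² − x`, is not a square in `ℤ/p` (`p ≠ 0`). [folklore] -/
theorem not_isSquare_of_forall [NeZero p] {x : ℤ} (h : ∀ t : ℕ, t < p → ¬ ((p : ℤ) ∣ (t : ℤ) ^ 2 - x)) :
    ¬ IsSquare ((x : ℤ) : ZMod p) := by
  rintro ⟨r, hr⟩
  apply h r.val (ZMod.val_lt r)
  rw [← ZMod.intCast_zmod_eq_zero_iff_dvd]
  push_cast
  rw [ZMod.natCast_zmod_val, hr]
  ring

/-- `p ∤ x` means `x ≠ 0` in `ℤ/p`. [folklore] -/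
theorem ne_zero_of_not_dvd {x : ℤ} (h : ¬ ((p : ℤ) ∣ x)) : ((x : ℤ) : ZMod p) ≠ 0 :=
  fun h0 => h ((ZMod.intCast_zmod_eq_zero_iff_dvd _ p).mp h0)

/-- **`ρ̄_{E,p}` surjective from a passing Serre witness** (for `W/ℚ` globally minimal elliptic with
integral model `e`): the three Frobenius elements at `l₁, l₂, l₃` satisfy Serre's conditions (split
with non-zero trace / non-split with non-zero trace / `u ∉ {0,1,2,4}`, `u² − 3u + 1 ≠ 0`), so the image
is `GL₂(𝔽_p)` (tree theorem `hasSurjectiveModNGaloisRep_of_intModel_of_serreWitnesses`, Serre 1972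
Prop. 19). [cite: Serre1972, §2.8 Prop. 19 and §5.2 (iii)] [cite: Mazur1978, §6 Prop. 6.3 (1) (p. 153)] -/
theorem surj_of_check (h : s.check e p = true) [Fact p.Prime] (W : WeierstrassCurve ℚ) [W.IsElliptic]
    [W.IsGloballyMinimal] (hI : integralModelInt W = e) : W.HasSurjectiveModNGaloisRep p := by
  simp only [check, Bool.and_eq_true, decide_eq_true_eq, List.all_eq_true, List.mem_range,
    Bool.not_eq_true', decide_eq_false_iff_not] at h
  obtain ⟨⟨⟨⟨⟨⟨⟨⟨⟨⟨⟨⟨⟨⟨⟨h5, hP1⟩, hP2⟩, hP3⟩, hw1⟩, hd1⟩, ha1⟩, hall2⟩, ha2⟩, hup⟩, hu⟩, hu0⟩, hu1⟩,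
    hu2⟩, hu4⟩, huu⟩ := h
  obtain ⟨hl1, h12, h1p, hΔ1, hc1⟩ := primeOK_spec hP1
  obtain ⟨hl2, h22, h2p, hΔ2, hc2⟩ := primeOK_spec hP2
  obtain ⟨hl3, h32, h3p, hΔ3, hc3⟩ := primeOK_spec hP3
  haveI : Fact s.l₁.Prime := ⟨hl1⟩
  haveI : Fact s.l₂.Prime := ⟨hl2⟩
  haveI : Fact s.l₃.Prime := ⟨hl3⟩
  haveI : NeZero p := ⟨(Fact.out : p.Prime).ne_zero⟩
  have hcard1 : Nat.card ((e.map (Int.castRingHom (ZMod s.l₁))).toAffine.Point) = s.n₁ := by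
    rw [card_eq_curveCount s.l₁ h12 e hΔ1, hc1]
  have hcard2 : Nat.card ((e.map (Int.castRingHom (ZMod s.l₂))).toAffine.Point) = s.n₂ := by
    rw [card_eq_curveCount s.l₂ h22 e hΔ2, hc2]
  have hcard3 : Nat.card ((e.map (Int.castRingHom (ZMod s.l₃))).toAffine.Point) = s.n₃ := by
    rw [card_eq_curveCount s.l₃ h32 e hΔ3, hc3]
  -- the integer Frobenius traces, and small-nat injectivity into `ZMod p`
  have hne : ∀ k : ℕ, k < p → s.u ≠ k → (s.u : ZMod p) ≠ (k : ZMod p) := by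
    intro k hk hne h
    have h' := (ZMod.natCast_eq_natCast_iff' s.u k p).mp h
    rw [Nat.mod_eq_of_lt hup, Nat.mod_eq_of_lt hk] at h'
    exact hne h'
  have hp5 : 5 ≤ p := h5
  refine hasSurjectiveModNGaloisRep_of_intModel_of_serreWitnesses hI p h5 s.l₁ s.l₂ s.l₃ h1p h2p h3p
    hΔ1 hΔ2 hΔ3 hcard1 hcard2 hcard3 ⟨?_, ?_, ?_⟩ ⟨?_, ?_⟩ ⟨(s.u : ZMod p), ?_, ?_, ?_, ?_, ?_, ?_⟩
  · have := isSquare_of_dvd (p := p) hw1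
    push_cast at this ⊢
    exact this
  · have := ne_zero_of_not_dvd (p := p) hd1
    push_cast at this ⊢
    exact this
  · have := ne_zero_of_not_dvd (p := p) ha1
    push_cast at this ⊢
    exact this
  · have := not_isSquare_of_forall (p := p) hall2
    push_cast at this ⊢
    exact this
  · have := ne_zero_of_not_dvd (p := p) ha2
    push_cast at this ⊢
    exact this
  · have h0 : ((((s.l₃ : ℤ) + 1 - s.n₃) ^ 2 - s.u * s.l₃ : ℤ) : ZMod p) = 0 :=
      (ZMod.intCast_zmod_eq_zero_iff_dvd _ p).mpr hu
    push_cast at h0 ⊢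
    linear_combination h0
  · have := hne 0 (by omega) hu0
    simpa using this
  · have := hne 1 (by omega) hu1
    simpa using this
  · have := hne 2 (by omega) hu2
    simpa using this
  · have := hne 4 (by omega) hu4
    simpa using this
  · have := ne_zero_of_not_dvd (p := p) huu
    push_cast at this ⊢
    exact this

end SurjWitness

end Summit.BirchSwinnertonDyer.BirchSwinnertonDyer.Rank2Sha

end
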